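import Literature.Probability.Percolation.MarkedLoopBoundarySpanInduction
import Literature.Probability.LatticeModels.TemperleyLiebCapSpanInitial
import HarnessLib

/-!
# Boundary span by induction on the number of marks, caps between CORNERS only; the all-`k` induction scheme («BSPAN-INDUCTION-CORNERS»)

Topic `Literature/Probability/Percolation`; generic-`k` layer of the marked-loop (Khristoforov–Smirnov) lineage; a rider on `MarkedLoopBoundarySpanInduction.lean`
(«BSPAN-INDUCTION-CRITERION»: ★★★ `bSpan_of_capInsL_laws` — `BSpan (k+2)` from spanning families `S j` of home-arc laws of `k`-marked domains whose cap insertions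
`capInsL j` lie in the span of the `(k+2)`-laws, over ALL `k + 2` cap positions of the module of `k + 3` sites) and on `LatticeModels/TemperleyLiebCapSpanInitial.lean`
(«TL-CAP-SPAN-INITIAL»: ★★★ `span_eq_top_of_capInsL_castSucc_mem_span` — the inductive spanning criterion needs the INITIAL cap positions only).

The home-arc law `lawLP z : LinkPattern (k+1) →₀ ℂ` lists the `k` corners `u_1, …, u_k` first and the observation mid-edge `z` LAST (`MarkedLoopBoundaryLawModule.lean`). A cap
inserted by boundary surgery is a pair of NEW CONSECUTIVE CORNERS (HOME `FINDING-BSPAN-TOWER-IDENTITY.md` §2, F1: two marks on an attached external hexagon), so it sits at an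
initial position `Fin.castSucc j`, `j : Fin (k+1)` — between two old points or after the last corner `u_k` and before `z`, never after `z`. This file restates the criterion
with exactly these positions, and packages the resulting INDUCTION ON `k`:

* ★★★ `bNonvanish_of_capInsL_laws_corners` / `bSpan_of_capInsL_laws_corners` (home arc) / ★★ `bSpan_of_capInsL_laws_corners'` (every arc) — `BSpan (k+2)` and `BNonvanish (k+2)`
  from: for every initial position `j : Fin (k+1)` a family `S j` of home-arc boundary mid-edges of `k`-marked domains whose laws span the planar module of `k + 1` sites, such that
  every `capInsL (Fin.castSucc j) (lawLP z)`, `z ∈ S j`, lies in the span of the home-arc laws of the `(k+2)`-marked domains;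
* ★ `bSpan_succ_of_bNonvanish_of_capInsL_corners` — the whole-family form (`S j` = everything, given `BNonvanish k` on the home arc);
* ★★★ `bSpan_of_induction_corners` — **THE INDUCTION SCHEME FOR ALL `k`**: given `BNonvanish (2m₀+1)` on the home arc (a base level) and, for every `m ≥ m₀` and every initial
  position `j : Fin (2m+2)`, a sub-family `S m j` of home-arc mid-edges of `(2m+1)`-marked domains such that (W) EVERY home-arc law of a `(2m+1)`-marked domain lies in the span
  of the laws of `S m j` («re-rooming»: the sub-family is as good as the whole family) and (F) every cap insertion `capInsL (Fin.castSucc j) (lawLP z)`, `z ∈ S m j`, lies in the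
  span of the home-arc laws of the `(2m+3)`-marked domains («one-hexagon surgery in gap `j`»), then `BSpan (2m+1) a` and `BNonvanish (2m+1) a` hold for EVERY `m ≥ m₀` and
  EVERY arc `a`.

The two hypotheses (W), (F) are what the lane's surgery calculus is to deliver (HOME `FINDING-BSPAN-SLIDE-INDUCTION.md`: `S m j` = the mid-edges of domains with an attachable
external hexagon in gap `j`; (F) = the decomposition F1 `capInsL j (law D̂) = law(D̂ ∪ h; two marks on h) − law(D̂; two marks at the contact ends of h)`; (W) = iterated one-mark
SLIDES `law(D ∪ h; u ↦ a) = law(D) + law(D; u ↦ q)` re-rooming a tight gap); neither is in this file, and nothing about their truth is claimed here.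

## References
* M. Khristoforov, S. Smirnov, *Percolation and O(1) loop model*, arXiv:2111.15612 (2021), §1.2 (arXiv v1 p. 2: the law of the link pattern), §2 Lemma 4 (p. 4), eq. (4)
  and Remark 6 (p. 5).
* P. A. Pearce, V. Rittenberg, J. de Gier, B. Nienhuis, *Temperley–Lieb stochastic processes*, J. Phys. A 35 (2002) L661–L668, §2 (link patterns; the monoid move).

## Mathlib / tree
Tree: `MarkedLoopBoundarySpanInduction` (the all-positions criterion, for comparison), `MarkedLoopBoundaryLawModule` (`lawLP`, `bNonvanish_last_iff_span_lawLP`),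
`MarkedLoopBoundarySpan` (`ArcPoint`, `BSpan`, `BNonvanish`, `bSpan_iff_bNonvanish`, `bNonvanish_iff`), `LatticeModels/TemperleyLiebCapSpanInitial`
(`span_eq_top_of_capInsL_castSucc_mem_span`), `LatticeModels/TemperleyLiebCapContract` (`capInsL`). Mathlib: `Submodule.span_le`, `Nat.le_induction`.
-/

open Finset

namespace Literature.Probability.Percolation.MarkedLoops

open Literature.Probability.Percolation Literature.Probability.LatticeModels
open Literature.Probability.LatticeModels.TemperleyLieb
open TriMarkedDomain

section InductionCorners

variable {m : ℕ}

/-- ★★★ **THE INDUCTIVE CRITERION FOR BOUNDARY NON-DEGENERACY, CAPS BETWEEN CORNERS ONLY** (`k = 2m+1 → k+2`): for every INITIAL cap position `j : Fin (k+1)` let `S j` be a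
set of home-arc boundary mid-edges of `k`-marked domains whose laws span the planar module of `k+1` sites; if every cap-inserted law `capInsL (Fin.castSucc j) (lawLP z)`,
`z ∈ S j`, lies in the span of the home-arc laws of the `(k+2)`-marked domains, then `BNonvanish (k+2)` holds on the home arc — no hypothesis at the last position (a cap after
the observation mid-edge `z`). [cite: KhristoforovSmirnov2021, §2 Lemma 4 (arXiv v1 p. 4), eq. (4) and Remark 6 (p. 5); PearceRittenbergDeGierNienhuis2002, §2] -/
theorem bNonvanish_of_capInsL_laws_corners
    (S : Fin (2 * m + 2) → Set (Σ D : TriMarkedDomain (2 * m + 1), ArcPoint D (Fin.last (2 * m))))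
    (hS : ∀ j, Submodule.span ℂ (Set.range fun zz : S j => lawLP zz.1.2) = ⊤)
    (hcap : ∀ j (zz : S j), capInsL ℂ (Fin.castSucc j) (lawLP zz.1.2) ∈
      Submodule.span ℂ (Set.range fun ww : (Σ D : TriMarkedDomain (2 * m + 2 + 1), ArcPoint D (Fin.last (2 * m + 2))) => lawLP ww.2)) :
    BNonvanish (2 * m + 2 + 1) (Fin.last (2 * m + 2)) := by
  rw [bNonvanish_last_iff_span_lawLP]
  exact span_eq_top_of_capInsL_castSucc_mem_span (fun ww : (Σ D : TriMarkedDomain (2 * m + 2 + 1), ArcPoint D (Fin.last (2 * m + 2))) => lawLP ww.2)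
    (fun j (zz : S j) => lawLP zz.1.2) hS hcap

/-- ★★★ **… AND FOR BOUNDARY SPAN** on the home arc of the `(k+2)`-marked domains. [cite: KhristoforovSmirnov2021, §2 eq. (4) and Remark 6 (arXiv v1 p. 5); PearceRittenbergDeGierNienhuis2002, §2] -/
theorem bSpan_of_capInsL_laws_corners
    (S : Fin (2 * m + 2) → Set (Σ D : TriMarkedDomain (2 * m + 1), ArcPoint D (Fin.last (2 * m))))
    (hS : ∀ j, Submodule.span ℂ (Set.range fun zz : S j => lawLP zz.1.2) = ⊤)
    (hcap : ∀ j (zz : S j), capInsL ℂ (Fin.castSucc j) (lawLP zz.1.2) ∈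
      Submodule.span ℂ (Set.range fun ww : (Σ D : TriMarkedDomain (2 * m + 2 + 1), ArcPoint D (Fin.last (2 * m + 2))) => lawLP ww.2)) :
    BSpan (2 * m + 2 + 1) (Fin.last (2 * m + 2)) :=
  (bSpan_iff_bNonvanish _).2 (bNonvanish_of_capInsL_laws_corners S hS hcap)

/-- ★★ **… on EVERY arc** of the `(k+2)`-marked domains (arc independence). [cite: KhristoforovSmirnov2021, §1.2 (arXiv v1 p. 2: cyclic indexing); §2 eq. (4) (p. 5)] -/
theorem bSpan_of_capInsL_laws_corners'
    (S : Fin (2 * m + 2) → Set (Σ D : TriMarkedDomain (2 * m + 1), ArcPoint D (Fin.last (2 * m))))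
    (hS : ∀ j, Submodule.span ℂ (Set.range fun zz : S j => lawLP zz.1.2) = ⊤)
    (hcap : ∀ j (zz : S j), capInsL ℂ (Fin.castSucc j) (lawLP zz.1.2) ∈
      Submodule.span ℂ (Set.range fun ww : (Σ D : TriMarkedDomain (2 * m + 2 + 1), ArcPoint D (Fin.last (2 * m + 2))) => lawLP ww.2))
    (a : Fin (2 * m + 2 + 1)) : BSpan (2 * m + 2 + 1) a ∧ BNonvanish (2 * m + 2 + 1) a := by
  have h := bNonvanish_of_capInsL_laws_corners S hS hcap
  have ha : BNonvanish (2 * m + 2 + 1) a := (bNonvanish_iff (n := 2 * m + 1) a (Fin.last (2 * m + 2))).2 h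
  exact ⟨(bSpan_iff_bNonvanish a).2 ha, ha⟩

/-- ★ **the sub-family form with re-rooming**: if `BNonvanish k` holds on the home arc, and for every initial position `j` a sub-family `S j` is AS GOOD AS THE WHOLE FAMILY (every
home-arc law of a `k`-marked domain lies in the span of the laws of `S j`) and has its `j`-th cap insertions in the span of the `(k+2)`-laws, then `BSpan (k+2)` and `BNonvanish (k+2)`
on every arc. [cite: KhristoforovSmirnov2021, §2 eq. (4) and Remark 6 (arXiv v1 p. 5); PearceRittenbergDeGierNienhuis2002, §2] -/
theorem bSpan_succ_of_bNonvanish_of_capInsL_corners (hlow : BNonvanish (2 * m + 1) (Fin.last (2 * m)))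
    (S : Fin (2 * m + 2) → Set (Σ D : TriMarkedDomain (2 * m + 1), ArcPoint D (Fin.last (2 * m))))
    (hW : ∀ j (D : TriMarkedDomain (2 * m + 1)) (z : ArcPoint D (Fin.last (2 * m))),
      lawLP z ∈ Submodule.span ℂ (Set.range fun zz : S j => lawLP zz.1.2))
    (hcap : ∀ j (zz : S j), capInsL ℂ (Fin.castSucc j) (lawLP zz.1.2) ∈
      Submodule.span ℂ (Set.range fun ww : (Σ D : TriMarkedDomain (2 * m + 2 + 1), ArcPoint D (Fin.last (2 * m + 2))) => lawLP ww.2))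
    (a : Fin (2 * m + 2 + 1)) : BSpan (2 * m + 2 + 1) a ∧ BNonvanish (2 * m + 2 + 1) a := by
  have hspan := bNonvanish_last_iff_span_lawLP.1 hlow
  refine bSpan_of_capInsL_laws_corners' S (fun j => ?_) hcap a
  -- the sub-family spans: the whole family spans and lies in the span of the sub-family
  rw [← top_le_iff, ← hspan]
  refine Submodule.span_le.2 ?_
  rintro _ ⟨ww, rfl⟩
  exact hW j ww.1 ww.2

/-- ★★★ **THE INDUCTION SCHEME FOR BOUNDARY SPAN AT EVERY NUMBER OF MARKS.** Suppose boundary non-degeneracy holds on the home arc at a base level `k₀ = 2m₀+1`, and for every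
`m ≥ m₀` and every initial cap position `j : Fin (2m+2)` a sub-family `S m j` of home-arc mid-edges of `(2m+1)`-marked domains is given with
(W) every home-arc law of a `(2m+1)`-marked domain in the span of the laws of `S m j`, and
(F) every cap insertion `capInsL (Fin.castSucc j) (lawLP z)`, `z ∈ S m j`, in the span of the home-arc laws of the `(2m+3)`-marked domains.
Then `BSpan (2m+1) a` and `BNonvanish (2m+1) a` hold for every `m ≥ m₀` and every arc `a`. (The lane's intended instance: `S m j` = domains with an attachable external hexagon in
gap `j`; (F) = the one-hexagon decomposition F1; (W) = re-rooming by iterated one-mark slides — none of which is claimed here.)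
[cite: KhristoforovSmirnov2021, §2 Lemma 4 (arXiv v1 p. 4), eq. (4) and Remark 6 (p. 5); §1.2 (p. 2); PearceRittenbergDeGierNienhuis2002, §2] -/
theorem bSpan_of_induction_corners (m₀ : ℕ) (hbase : BNonvanish (2 * m₀ + 1) (Fin.last (2 * m₀)))
    (S : ∀ m : ℕ, Fin (2 * m + 2) → Set (Σ D : TriMarkedDomain (2 * m + 1), ArcPoint D (Fin.last (2 * m))))
    (hW : ∀ m, m₀ ≤ m → ∀ j (D : TriMarkedDomain (2 * m + 1)) (z : ArcPoint D (Fin.last (2 * m))),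
      lawLP z ∈ Submodule.span ℂ (Set.range fun zz : S m j => lawLP zz.1.2))
    (hF : ∀ m, m₀ ≤ m → ∀ j (zz : S m j), capInsL ℂ (Fin.castSucc j) (lawLP zz.1.2) ∈
      Submodule.span ℂ (Set.range fun ww : (Σ D : TriMarkedDomain (2 * m + 2 + 1), ArcPoint D (Fin.last (2 * m + 2))) => lawLP ww.2))
    {m : ℕ} (hm : m₀ ≤ m) (a : Fin (2 * m + 1)) : BSpan (2 * m + 1) a ∧ BNonvanish (2 * m + 1) a := by
  -- induction on `m ≥ m₀` for the home-arc statement, then arc independence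
  have key : ∀ m, m₀ ≤ m → BNonvanish (2 * m + 1) (Fin.last (2 * m)) := by
    intro m hm
    induction m, hm using Nat.le_induction with
    | base => exact hbase
    | succ m hm ih => exact (bSpan_succ_of_bNonvanish_of_capInsL_corners ih (S m) (hW m hm) (hF m hm) (Fin.last (2 * m + 2))).2
  have h := key m hm
  -- every arc: `k = 1` has one arc; `k ≥ 3` by arc independence
  rcases Nat.eq_zero_or_pos m with rfl | hpos
  · have ha : a = Fin.last 0 := Fin.ext (by have := a.2; simp only [Fin.val_last]; omega)
    subst ha
    exact ⟨(bSpan_iff_bNonvanish _).2 h, h⟩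
  · obtain ⟨m', rfl⟩ : ∃ m', m = m' + 1 := ⟨m - 1, by omega⟩
    have ha : BNonvanish (2 * (m' + 1) + 1) a := (bNonvanish_iff (n := 2 * m' + 1) a (Fin.last (2 * (m' + 1)))).2 h
    exact ⟨(bSpan_iff_bNonvanish a).2 ha, ha⟩

end InductionCorners

end Literature.Probability.Percolation.MarkedLoops
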